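import Mathlib.RepresentationTheory.Intertwining
import Mathlib.RepresentationTheory.Irreducible
import Mathlib.RingTheory.SimpleModule.Isotypic
import Mathlib.RingTheory.SimpleModule.Rank
import Mathlib.LinearAlgebra.TensorProduct.Basic
import Mathlib.LinearAlgebra.Dual.Lemmas
import Literature.RepresentationTheory.IsotypicEvaluation
import HarnessLib

/-!
# Finite-family isotypic rigidity: a jointly irreducible module for a finite family of commuting group actions is
# determined by its isotypic types

Topic `RepresentationTheory`; namespace `Literature.RepresentationTheory`.  THEOREMS ONLY (no definition, no named fact,
no instance), over ★ `Literature.RepresentationTheory.IsotypicEvaluation` (isotypic calculus `X ≅ T ⊗_k Hom_G(τ, X)`).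

SETTING.  `k` a field; groups `(G i)_{i ∈ ι}` acting on a `k`-space `X` through PAIRWISE COMMUTING representations
`ρ i` (family form — what the `K^S`-fixed vectors of a representation of a restricted product carry for `v ∈ S`; no
product group is formed); irreducible `τ i : G i → GL(V i)` with SCALAR COMMUTANT (`∀ φ ∈ Hom_{G i}(τ i, τ i), ∃ c,
φ = c • id`, the shape of ★ `intertwiningMap_injective_of_forall_apply_tmul`); ISOTYPY as
`isotypicComponent k[G i] (ρ i).asModule (τ i).asModule = ⊤`; JOINT IRREDUCIBILITY in lattice form (`X ≠ 0`, every
`k`-submodule stable under all `ρ i g` is `⊥` or `⊤`).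
§1 (two groups).  The MULTIPLICITY SPACE `Hom_H(τ, X) = τ.IntertwiningMap π` of an irreducible `τ` of `H`: a group `L`
acting on `X` through `σ` commuting with `π` acts on it by post-composition (`exists_representation_intertwiningMap_apply`,
an EXISTENCE statement); it is non-zero when `X ≠ 0` is `τ`-isotypic; and it INHERITS ISOTYPY from `σ`
(`intertwiningMap_isotypicComponent_eq_top`: evaluation at `v₀ ≠ 0` is an injective `L`-map into `X`).
§2 (family).  `exists_multiplicityRep` (the `G i`, `i ≠ i₀`, act by post-composition, `G i₀` trivially); the
multiplicity space INHERITS JOINT IRREDUCIBILITY (`multiplicity_eq_bot_or_eq_top`, via injectivity of the evaluation map);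
the empty family.
§3 RIGIDITY (`exists_equiv_of_isotypic`): two non-zero jointly irreducible `X₁`, `X₂` that are `τ i`-isotypic for every
`i` of a FINITE `ι` are isomorphic equivariantly for the whole family (induction on the active indices through
`X_j ≅ V i₀ ⊗ Hom_{G i₀}(τ i₀, X_j)`; both sides are `≅ ⨂_i τ i`).  This is the uniqueness half of the classification of
irreducible modules over a finite tensor product (Bump 1997 Prop. 3.4.1–3.4.2 after Bourbaki *Algèbre* VIII §7:
`N₁ = Hom_A(M, P)` as a `B`-module, `λ(m ⊗ n) = n(m)`; Bernstein–Zelevinsky 1976 §2.16; Flath 1979 Thm. 1), with the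
scalar-commutant hypothesis in place of finite dimension and algebraic closure.
NOT here: Schur's lemma (the scalar commutant is a hypothesis), Hecke operators, restricted tensor products.

## References
* D. Bump, *Automorphic Forms and Representations* (1997), §3.4, Prop. 3.4.1, Prop. 3.4.2 (PDF p. 302).
* I. N. Bernstein, A. V. Zelevinsky, Russian Math. Surveys 31 (1976), §2.16.
* D. Flath, *Decomposition of representations into tensor products*, PSPM 33.1 (1979), Thm. 1.
* N. Bourbaki, *Algèbre*, Ch. VIII (2012 ed.), §7.
-/

set_option autoImplicit false

noncomputable section

open scoped TensorProduct

namespace Literature.RepresentationTheory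

universe u

/-! ## §1 The multiplicity space `Hom_{G i₀}(τ, X)`: post-composition action, non-vanishing, isotypy -/

section MultiplicitySpace

variable {k : Type*} [Field k] {H L : Type*} [Group H] [Group L]
  {V : Type*} [AddCommGroup V] [Module k V] {X : Type*} [AddCommGroup X] [Module k X]
  (τ : Representation k H V) (π : Representation k H X) (σ : Representation k L X)

/-- **Post-composition action on the multiplicity space.**  If `L` acts on `X` through `σ` commuting with the action
`π` of `H`, then `L` acts `k`-linearly on `Hom_H(τ, π) = τ.IntertwiningMap π` by `(l • f) v = σ l (f v)`: there is a
representation `σM` of `L` on `τ.IntertwiningMap π` with this formula (Bump 1997, proof of Prop. 3.4.1: "we make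
`N₁ = Hom_A(M, P)` a `B`-module by `(bn)(m) = b · n(m)`"). [cite: Bump1997, Prop. 3.4.1] -/
theorem exists_representation_intertwiningMap_apply (hc : ∀ (l : L) (h : H), σ l ∘ₗ π h = π h ∘ₗ σ l) :
    ∃ σM : Representation k L (τ.IntertwiningMap π),
      ∀ (l : L) (f : τ.IntertwiningMap π) (v : V), σM l f v = σ l (f v) := by
  let post : L → τ.IntertwiningMap π →ₗ[k] τ.IntertwiningMap π := fun l =>
    { toFun := fun f =>
        { toLinearMap := σ l ∘ₗ f.toLinearMap
          isIntertwining' := fun h => by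
            rw [LinearMap.comp_assoc, f.isIntertwining', ← LinearMap.comp_assoc, hc l h,
              LinearMap.comp_assoc] }
      map_add' := fun f f' => by ext v; simp
      map_smul' := fun c f => by ext v; simp }
  have post_apply : ∀ (l : L) (f : τ.IntertwiningMap π) (v : V), post l f v = σ l (f v) := fun l f v => rfl
  refine ⟨{ toFun := post
            map_one' := by ext f v; simp [post_apply]
            map_mul' := fun l l' => by ext f v; simp [post_apply] }, fun l f v => ?_⟩
  simp only [MonoidHom.coe_mk, OneHom.coe_mk, post_apply]

/-- A non-zero vector of an irreducible representation. [folklore] -/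
private theorem exists_ne_zero_of_isIrreducible [τ.IsIrreducible] : ∃ v : V, v ≠ 0 := by
  haveI : Nontrivial τ.asModule := IsSimpleModule.nontrivial (MonoidAlgebra k H) τ.asModule
  obtain ⟨v, hv⟩ := exists_ne (0 : τ.asModule)
  exact ⟨v, hv⟩

variable {τ π} in
/-- An intertwining map out of an irreducible representation killing a non-zero vector is zero. [folklore] -/
private theorem intertwiningMap_eq_zero_of_apply_eq_zero [τ.IsIrreducible] (f : τ.IntertwiningMap π) {v : V}
    (hv : v ≠ 0) (hfv : f v = 0) : f = 0 := by
  rcases Representation.IsIrreducible.injective_or_eq_zero f with hinj | h0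
  · exact absurd (hinj (hfv.trans (map_zero f).symm)) hv
  · exact h0

/-- **The multiplicity space of a non-zero isotypic module is non-zero**: if `X ≠ 0` is `τ`-isotypic for an
irreducible `τ` with scalar commutant, `Hom_H(τ, X) ≠ 0` (the evaluation map `V ⊗ Hom_H(τ, X) → X` is onto, ★
`intertwiningMap_exists_linearEquiv_apply_tmul`). [cite: Bump1997, Prop. 3.4.1] -/
theorem intertwiningMap_nontrivial_of_isotypicComponent_eq_top [τ.IsIrreducible] [Nontrivial X]
    (hs : ∀ φ : τ.IntertwiningMap τ, ∃ c : k, ∀ x, φ x = c • x)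
    (hX : isotypicComponent (MonoidAlgebra k H) π.asModule τ.asModule = ⊤) :
    Nontrivial (τ.IntertwiningMap π) := by
  by_contra h
  rw [not_nontrivial_iff_subsingleton] at h
  obtain ⟨x, hx⟩ := exists_ne (0 : X)
  obtain ⟨E, hE⟩ := intertwiningMap_exists_linearEquiv_apply_tmul τ π hs hX
  obtain ⟨t, rfl⟩ := E.surjective x
  refine hx ?_
  induction t using TensorProduct.induction_on with
  | zero => simp
  | tmul v f => rw [hE, Subsingleton.elim f 0]; rfl
  | add a b ha hb =>
    rw [map_add, ha fun h' => ?_, hb fun h' => ?_, add_zero] <;> simp_all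

/-- **The multiplicity space inherits isotypy.**  Let `τ` be an irreducible representation of `H` on `V`, `π` a
representation of `H` on `X`, and `σ` a representation of another group `L` on `X`; let `σM` be ANY representation of
`L` on `Hom_H(τ, π)` acting by post-composition, `(σM l f) v = σ l (f v)`.  If `X` is `ξ`-isotypic for `σ`
(`ξ` irreducible), then `Hom_H(τ, π)` is `ξ`-isotypic for `σM`: evaluation at a non-zero `v₀ ∈ V` is an INJECTIVE
`L`-equivariant map `Hom_H(τ, π) → X` (an intertwiner out of the irreducible `τ` vanishing at `v₀` is zero), and a
submodule of the semisimple `ξ`-isotypic `k[L]`-module `X` is semisimple and `ξ`-isotypic (Mathlib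
`IsIsotypicOfType.of_injective`, `isotypicComponent_eq_top_iff`).  (Bump 1997, proof of Prop. 3.4.1: "`P` is, as an
`A`-module, a direct sum of `d` copies of `M`".) [cite: Bump1997, Prop. 3.4.1] -/
theorem intertwiningMap_isotypicComponent_eq_top [τ.IsIrreducible]
    (σM : Representation k L (τ.IntertwiningMap π))
    (hσM : ∀ (l : L) (f : τ.IntertwiningMap π) (v : V), σM l f v = σ l (f v))
    {T : Type*} [AddCommGroup T] [Module k T] (ξ : Representation k L T) [ξ.IsIrreducible]
    (hX : isotypicComponent (MonoidAlgebra k L) σ.asModule ξ.asModule = ⊤) :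
    isotypicComponent (MonoidAlgebra k L) σM.asModule ξ.asModule = ⊤ := by
  obtain ⟨v₀, hv₀⟩ := exists_ne_zero_of_isIrreducible τ
  -- evaluation at `v₀`, an `L`-equivariant injection of the multiplicity space into `X`
  let ev : σM.IntertwiningMap σ :=
    { toFun := fun f => f v₀
      map_add' := fun f f' => rfl
      map_smul' := fun c f => rfl
      isIntertwining' := fun l => by ext f; simp [hσM] }
  have hev : Function.Injective ev := by
    intro f f' h
    have h0 : (f - f') v₀ = 0 := by
      change f v₀ - f' v₀ = 0
      exact sub_eq_zero.mpr h
    exact sub_eq_zero.mp (intertwiningMap_eq_zero_of_apply_eq_zero (f - f') hv₀ h0)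
  let j := Representation.IntertwiningMap.equivLinearMapAsModule σM σ ev
  have hj : Function.Injective j := hev
  haveI : IsSemisimpleModule (MonoidAlgebra k L) σ.asModule := by
    haveI : IsSemisimpleModule (MonoidAlgebra k L) (⊤ : Submodule (MonoidAlgebra k L) σ.asModule) := by
      rw [← hX]; infer_instance
    exact IsSemisimpleModule.congr (Submodule.topEquiv.symm : σ.asModule ≃ₗ[MonoidAlgebra k L] _)
  haveI : IsSemisimpleModule (MonoidAlgebra k L) σM.asModule := IsSemisimpleModule.congr (LinearEquiv.ofInjective j hj)
  exact isotypicComponent_eq_top_iff.mpr (.of_injective (.of_isotypicComponent_eq_top hX) j hj)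

end MultiplicitySpace

/-! ## §2 A finite family of commuting actions: the multiplicity space at one index -/

section Family

variable {k : Type*} [Field k] {ι : Type*} {G : ι → Type*} [∀ i, Group (G i)]
  {V : Type*} [AddCommGroup V] [Module k V] {X : Type*} [AddCommGroup X] [Module k X]

/-- **Multiplicity-space actions for a commuting family.**  For a pairwise commuting family `ρ i : G i → GL(X)` and a
representation `τ` of `G i₀`, there is a family of representations `ρM i` of the `G i` on `Hom_{G i₀}(τ, X)` with
`(ρM i g f) v = ρ i g (f v)` for `i ≠ i₀` (post-composition) and `ρM i₀ g f = f` (trivial action at `i₀`).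
(Bump 1997, proof of Prop. 3.4.1, one index at a time.) [cite: Bump1997, Prop. 3.4.1] -/
theorem exists_multiplicityRep (ρ : ∀ i, Representation k (G i) X)
    (hc : Pairwise fun i j => ∀ (g : G i) (h : G j), ρ i g ∘ₗ ρ j h = ρ j h ∘ₗ ρ i g)
    (i₀ : ι) (τ : Representation k (G i₀) V) :
    ∃ ρM : ∀ i, Representation k (G i) (τ.IntertwiningMap (ρ i₀)),
      (∀ i, i ≠ i₀ → ∀ (g : G i) (f : τ.IntertwiningMap (ρ i₀)) (v : V), ρM i g f v = ρ i g (f v)) ∧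
      (∀ (g : G i₀) (f : τ.IntertwiningMap (ρ i₀)), ρM i₀ g f = f) := by
  classical
  have h : ∀ i, i ≠ i₀ → ∃ σM : Representation k (G i) (τ.IntertwiningMap (ρ i₀)),
      ∀ (g : G i) (f : τ.IntertwiningMap (ρ i₀)) (v : V), σM g f v = ρ i g (f v) :=
    fun i hi => exists_representation_intertwiningMap_apply τ (ρ i₀) (ρ i) (hc hi)
  choose σM hσM using h
  refine ⟨fun i => if hi : i = i₀ then 1 else σM i hi, fun i hi g f v => ?_, fun g f => by simp⟩
  simp only [dif_neg hi, hσM i hi]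

/-- **The multiplicity space inherits joint irreducibility.**  Let the family `ρ` be such that every `k`-submodule of
`X` stable under all `ρ i g` is `⊥` or `⊤`, let `τ` be an irreducible representation of `G i₀` with scalar commutant,
and let `ρM` be representations of the `G i` on `Hom_{G i₀}(τ, X)` acting by post-composition for `i ≠ i₀`.  Then
every submodule `N` of `Hom_{G i₀}(τ, X)` stable under all `ρM i g` is `⊥` or `⊤`: the span `E` of `{f v | f ∈ N}` is
stable under the whole family, hence `⊥` (then `N = 0`) or `⊤`; in the latter case, for any `f`, injectivity of the
evaluation map `V ⊗ Hom_{G i₀}(τ, X) → X` (★ `intertwiningMap_injective_of_forall_apply_tmul`) puts `v₀ ⊗ f` in the image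
of `V ⊗ N`, and applying `φ ⊗ (· mod N)` with `φ v₀ = 1` gives `f ∈ N`.  (Bump 1997, Prop. 3.4.1–3.4.2: simplicity of
`P` forces simplicity of the multiplicity module.) [cite: Bump1997, Prop. 3.4.1] -/
theorem multiplicity_eq_bot_or_eq_top (ρ : ∀ i, Representation k (G i) X) (i₀ : ι)
    (τ : Representation k (G i₀) V) [τ.IsIrreducible]
    (hs : ∀ φ : τ.IntertwiningMap τ, ∃ c : k, ∀ x, φ x = c • x)
    (ρM : ∀ i, Representation k (G i) (τ.IntertwiningMap (ρ i₀)))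
    (hρM : ∀ i, i ≠ i₀ → ∀ (g : G i) (f : τ.IntertwiningMap (ρ i₀)) (v : V), ρM i g f v = ρ i g (f v))
    (hXirr : ∀ N : Submodule k X, (∀ i (g : G i), N ≤ N.comap (ρ i g)) → N = ⊥ ∨ N = ⊤)
    (N : Submodule k (τ.IntertwiningMap (ρ i₀))) (hN : ∀ i (g : G i), N ≤ N.comap (ρM i g)) :
    N = ⊥ ∨ N = ⊤ := by
  classical
  let S : Set X := {x | ∃ f ∈ N, ∃ v : V, f v = x}
  let E : Submodule k X := Submodule.span k S
  have hE : ∀ i (g : G i), E ≤ E.comap (ρ i g) := by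
    intro i g
    rw [← Submodule.map_le_iff_le_comap, Submodule.map_span]
    refine Submodule.span_mono ?_
    rintro _ ⟨x, ⟨f, hf, v, rfl⟩, rfl⟩
    by_cases hi : i = i₀
    · subst hi
      exact ⟨f, hf, τ g v, Representation.IntertwiningMap.isIntertwining _ _ f g v⟩
    · exact ⟨ρM i g f, hN i g hf, v, hρM i hi g f v⟩
  rcases hXirr E hE with hbot | htop
  · -- every `f ∈ N` vanishes identically
    left
    refine (Submodule.eq_bot_iff _).mpr fun f hf => ?_
    ext v
    have : f v ∈ E := Submodule.subset_span ⟨f, hf, v, rfl⟩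
    rw [hbot] at this
    simpa using this
  · right
    refine eq_top_iff.mpr fun f _ => ?_
    obtain ⟨v₀, hv₀⟩ := exists_ne_zero_of_isIrreducible τ
    obtain ⟨φ, hφ⟩ := Module.Projective.exists_dual_eq_one k hv₀
    -- the evaluation map `ev : V ⊗ Hom_{G i₀}(τ, X) → X`, injective by ★ `IsotypicEvaluation`
    let bil : V →ₗ[k] τ.IntertwiningMap (ρ i₀) →ₗ[k] X :=
      LinearMap.mk₂ k (fun v f => f v) (fun v v' f => map_add f v v') (fun c v f => map_smul f c v)
        (fun v f f' => rfl) (fun c v f => rfl)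
    let ev : V ⊗[k] τ.IntertwiningMap (ρ i₀) →ₗ[k] X := TensorProduct.lift bil
    have hev : ∀ (v : V) (f : τ.IntertwiningMap (ρ i₀)), ev (v ⊗ₜ[k] f) = f v := fun v f => by
      simp [ev, bil]
    have hinj := intertwiningMap_injective_of_forall_apply_tmul τ (ρ i₀) hs ev hev
    let ιN : V ⊗[k] N →ₗ[k] V ⊗[k] τ.IntertwiningMap (ρ i₀) := TensorProduct.map LinearMap.id N.subtype
    have hrange : E ≤ LinearMap.range (ev ∘ₗ ιN) := by
      refine Submodule.span_le.mpr ?_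
      rintro x ⟨f, hf, v, rfl⟩
      exact ⟨v ⊗ₜ ⟨f, hf⟩, by simp [ιN, hev]⟩
    have hfv : f v₀ ∈ LinearMap.range (ev ∘ₗ ιN) := hrange (by rw [htop]; trivial)
    obtain ⟨t, ht⟩ := hfv
    have key : ιN t = v₀ ⊗ₜ f := hinj (by simpa [hev] using ht)
    let Ψ : V ⊗[k] τ.IntertwiningMap (ρ i₀) →ₗ[k] k ⊗[k] (τ.IntertwiningMap (ρ i₀) ⧸ N) :=
      TensorProduct.map φ N.mkQ
    have hΨ : Ψ ∘ₗ ιN = 0 := by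
      simp only [Ψ, ιN, ← TensorProduct.map_comp, LinearMap.comp_id]
      have : N.mkQ ∘ₗ N.subtype = 0 := by ext; simp
      rw [this, TensorProduct.map_zero_right]
    have h1 : Ψ (v₀ ⊗ₜ f) = 0 := by
      rw [← key, ← LinearMap.comp_apply, hΨ, LinearMap.zero_apply]
    have h2 : Ψ (v₀ ⊗ₜ f) = (1 : k) ⊗ₜ N.mkQ f := by simp [Ψ, hφ]
    have h3 : N.mkQ f = 0 := by
      have := congrArg (TensorProduct.lid k (τ.IntertwiningMap (ρ i₀) ⧸ N)) (h2.symm.trans h1)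
      simpa using this
    simpa using h3

/-- The EMPTY family: two non-zero `k`-spaces each of whose submodules is `⊥` or `⊤` are isomorphic (both are lines,
Mathlib `isSimpleModule_iff_finrank_eq_one`). [folklore] -/
private theorem nonempty_linearEquiv_of_forall_eq_bot_or_eq_top (X₁ X₂ : Type u)
    [AddCommGroup X₁] [Module k X₁] [AddCommGroup X₂] [Module k X₂] [Nontrivial X₁] [Nontrivial X₂]
    (h₁ : ∀ N : Submodule k X₁, N = ⊥ ∨ N = ⊤) (h₂ : ∀ N : Submodule k X₂, N = ⊥ ∨ N = ⊤) :
    Nonempty (X₁ ≃ₗ[k] X₂) := by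
  haveI : IsSimpleModule k X₁ := { eq_bot_or_eq_top := h₁ }
  haveI : IsSimpleModule k X₂ := { eq_bot_or_eq_top := h₂ }
  have e₁ : Module.finrank k X₁ = 1 := isSimpleModule_iff_finrank_eq_one.mp inferInstance
  have e₂ : Module.finrank k X₂ = 1 := isSimpleModule_iff_finrank_eq_one.mp inferInstance
  haveI := Module.finite_of_finrank_eq_succ e₁
  haveI := Module.finite_of_finrank_eq_succ e₂
  exact ⟨LinearEquiv.ofFinrankEq X₁ X₂ (e₁.trans e₂.symm)⟩

end Family

/-! ## §3 Rigidity -/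

section Rigidity

variable {k : Type*} [Field k] {ι : Type*} {G : ι → Type*} [∀ i, Group (G i)]
  {V : ι → Type u} [∀ i, AddCommGroup (V i)] [∀ i, Module k (V i)]
  (τ : ∀ i, Representation k (G i) (V i)) [∀ i, (τ i).IsIrreducible]
  (hs : ∀ i (φ : (τ i).IntertwiningMap (τ i)), ∃ c : k, ∀ x, φ x = c • x)

include hs in
/-- Induction form of `exists_equiv_of_isotypic`: the actions are trivial off a finset `S` of "active" indices (which
alone carry the isotypy hypothesis); induction on `S` through the multiplicity spaces at an active `i₀`, reassembled
along `X_j ≅ V i₀ ⊗ Hom_{G i₀}(τ i₀, X_j)` (★ `intertwiningMap_exists_linearEquiv_apply_tmul`). [cite: Bump1997, Prop. 3.4.2] -/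
theorem exists_equiv_of_isotypic_aux (S : Finset ι) :
    ∀ (X₁ X₂ : Type u) [AddCommGroup X₁] [Module k X₁] [AddCommGroup X₂] [Module k X₂]
      [Nontrivial X₁] [Nontrivial X₂]
      (ρ₁ : ∀ i, Representation k (G i) X₁) (ρ₂ : ∀ i, Representation k (G i) X₂),
      (Pairwise fun i j => ∀ (g : G i) (h : G j), ρ₁ i g ∘ₗ ρ₁ j h = ρ₁ j h ∘ₗ ρ₁ i g) →
      (Pairwise fun i j => ∀ (g : G i) (h : G j), ρ₂ i g ∘ₗ ρ₂ j h = ρ₂ j h ∘ₗ ρ₂ i g) →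
      (∀ i, i ∉ S → ∀ g : G i, ρ₁ i g = 1) → (∀ i, i ∉ S → ∀ g : G i, ρ₂ i g = 1) →
      (∀ i ∈ S, isotypicComponent (MonoidAlgebra k (G i)) (ρ₁ i).asModule (τ i).asModule = ⊤) →
      (∀ i ∈ S, isotypicComponent (MonoidAlgebra k (G i)) (ρ₂ i).asModule (τ i).asModule = ⊤) →
      (∀ N : Submodule k X₁, (∀ i (g : G i), N ≤ N.comap (ρ₁ i g)) → N = ⊥ ∨ N = ⊤) →
      (∀ N : Submodule k X₂, (∀ i (g : G i), N ≤ N.comap (ρ₂ i g)) → N = ⊥ ∨ N = ⊤) →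
      ∃ e : X₁ ≃ₗ[k] X₂, ∀ i (g : G i), e.toLinearMap ∘ₗ ρ₁ i g = ρ₂ i g ∘ₗ e.toLinearMap := by
  classical
  induction S using Finset.induction with
  | empty =>
    intro X₁ X₂ _ _ _ _ _ _ ρ₁ ρ₂ _ _ h₁ h₂ _ _ hirr₁ hirr₂
    have h₁' : ∀ i (g : G i), ρ₁ i g = 1 := fun i g => h₁ i (Finset.notMem_empty i) g
    have h₂' : ∀ i (g : G i), ρ₂ i g = 1 := fun i g => h₂ i (Finset.notMem_empty i) g
    obtain ⟨e⟩ := nonempty_linearEquiv_of_forall_eq_bot_or_eq_top (k := k) X₁ X₂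
      (fun N => hirr₁ N fun i g x hx => by simpa [h₁'] using hx)
      (fun N => hirr₂ N fun i g x hx => by simpa [h₂'] using hx)
    exact ⟨e, fun i g => by rw [h₁', h₂']; ext x; simp⟩
  | insert i₀ S hi₀ IH =>
    intro X₁ X₂ _ _ _ _ _ _ ρ₁ ρ₂ hc₁ hc₂ h₁ h₂ hiso₁ hiso₂ hirr₁ hirr₂
    obtain ⟨ρM₁, hM₁, hM₁₀⟩ := exists_multiplicityRep ρ₁ hc₁ i₀ (τ i₀)
    obtain ⟨ρM₂, hM₂, hM₂₀⟩ := exists_multiplicityRep ρ₂ hc₂ i₀ (τ i₀)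
    have hX₁ := hiso₁ i₀ (Finset.mem_insert_self _ _)
    have hX₂ := hiso₂ i₀ (Finset.mem_insert_self _ _)
    haveI := intertwiningMap_nontrivial_of_isotypicComponent_eq_top (τ i₀) (ρ₁ i₀) (hs i₀) hX₁
    haveI := intertwiningMap_nontrivial_of_isotypicComponent_eq_top (τ i₀) (ρ₂ i₀) (hs i₀) hX₂
    have comm : ∀ {X : Type u} [AddCommGroup X] [Module k X] (ρ : ∀ i, Representation k (G i) X)
        (hc : Pairwise fun i j => ∀ (g : G i) (h : G j), ρ i g ∘ₗ ρ j h = ρ j h ∘ₗ ρ i g)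
        (ρM : ∀ i, Representation k (G i) ((τ i₀).IntertwiningMap (ρ i₀)))
        (hM : ∀ i, i ≠ i₀ → ∀ (g : G i) (f : (τ i₀).IntertwiningMap (ρ i₀)) (v : V i₀),
          ρM i g f v = ρ i g (f v))
        (hM₀ : ∀ (g : G i₀) (f : (τ i₀).IntertwiningMap (ρ i₀)), ρM i₀ g f = f),
        Pairwise fun i j => ∀ (g : G i) (h : G j), ρM i g ∘ₗ ρM j h = ρM j h ∘ₗ ρM i g := by
      intro X _ _ ρ hc ρM hM hM₀ i j hij g h
      ext f v
      simp only [LinearMap.comp_apply, Representation.IntertwiningMap.toLinearMap_apply]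
      rcases eq_or_ne i i₀ with rfl | hi
      · rw [hM₀, hM₀]
      rcases eq_or_ne j i₀ with rfl | hj
      · rw [hM₀, hM₀]
      rw [hM i hi, hM j hj, hM j hj, hM i hi]
      simpa using LinearMap.congr_fun (hc hij g h) (f v)
    have off : ∀ {X : Type u} [AddCommGroup X] [Module k X] (ρ : ∀ i, Representation k (G i) X)
        (hoff : ∀ i, i ∉ insert i₀ S → ∀ g : G i, ρ i g = 1)
        (ρM : ∀ i, Representation k (G i) ((τ i₀).IntertwiningMap (ρ i₀)))
        (hM : ∀ i, i ≠ i₀ → ∀ (g : G i) (f : (τ i₀).IntertwiningMap (ρ i₀)) (v : V i₀),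
          ρM i g f v = ρ i g (f v))
        (hM₀ : ∀ (g : G i₀) (f : (τ i₀).IntertwiningMap (ρ i₀)), ρM i₀ g f = f),
        ∀ i, i ∉ S → ∀ g : G i, ρM i g = 1 := by
      intro X _ _ ρ hoff ρM hM hM₀ i hi g
      ext f v
      simp only [Representation.IntertwiningMap.toLinearMap_apply]
      rcases eq_or_ne i i₀ with rfl | hne
      · rw [hM₀]; rfl
      · have : i ∉ insert i₀ S := by simp [hne, hi]
        rw [hM i hne, hoff i this g]; rfl
    obtain ⟨e', he'⟩ := IH ((τ i₀).IntertwiningMap (ρ₁ i₀)) ((τ i₀).IntertwiningMap (ρ₂ i₀)) ρM₁ ρM₂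
      (comm ρ₁ hc₁ ρM₁ hM₁ hM₁₀) (comm ρ₂ hc₂ ρM₂ hM₂ hM₂₀)
      (off ρ₁ h₁ ρM₁ hM₁ hM₁₀) (off ρ₂ h₂ ρM₂ hM₂ hM₂₀)
      (fun i hi => intertwiningMap_isotypicComponent_eq_top (τ i₀) (ρ₁ i₀) (ρ₁ i) (ρM₁ i)
        (hM₁ i (ne_of_mem_of_not_mem hi hi₀)) (τ i) (hiso₁ i (Finset.mem_insert_of_mem hi)))
      (fun i hi => intertwiningMap_isotypicComponent_eq_top (τ i₀) (ρ₂ i₀) (ρ₂ i) (ρM₂ i)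
        (hM₂ i (ne_of_mem_of_not_mem hi hi₀)) (τ i) (hiso₂ i (Finset.mem_insert_of_mem hi)))
      (fun N hN => multiplicity_eq_bot_or_eq_top ρ₁ i₀ (τ i₀) (hs i₀) ρM₁ hM₁ hirr₁ N hN)
      (fun N hN => multiplicity_eq_bot_or_eq_top ρ₂ i₀ (τ i₀) (hs i₀) ρM₂ hM₂ hirr₂ N hN)
    -- assemble `e := E₂ ∘ (1 ⊗ e') ∘ E₁⁻¹` from the isotypic calculus ★ `IsotypicEvaluation`
    obtain ⟨E₁, hE₁⟩ := intertwiningMap_exists_linearEquiv_apply_tmul (τ i₀) (ρ₁ i₀) (hs i₀) hX₁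
    obtain ⟨E₂, hE₂⟩ := intertwiningMap_exists_linearEquiv_apply_tmul (τ i₀) (ρ₂ i₀) (hs i₀) hX₂
    let e : X₁ ≃ₗ[k] X₂ := E₁.symm ≪≫ₗ TensorProduct.congr (LinearEquiv.refl k (V i₀)) e' ≪≫ₗ E₂
    have he : ∀ (v : V i₀) (f : (τ i₀).IntertwiningMap (ρ₁ i₀)), e (E₁ (v ⊗ₜ f)) = e' f v := by
      intro v f
      simp only [e, LinearEquiv.trans_apply, LinearEquiv.symm_apply_apply, TensorProduct.congr_tmul,
        LinearEquiv.refl_apply, hE₂]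
    refine ⟨e, fun i g => LinearMap.ext fun x => ?_⟩
    obtain ⟨t, rfl⟩ := E₁.surjective x
    simp only [LinearMap.comp_apply, LinearEquiv.coe_coe]
    induction t using TensorProduct.induction_on with
    | zero => simp
    | add a b ha hb => simp only [map_add, ha, hb]
    | tmul v f =>
      rcases eq_or_ne i i₀ with rfl | hne
      · rw [he, hE₁, ← Representation.IntertwiningMap.isIntertwining _ _ f g v, ← hE₁ (τ i g v) f, he]
        exact Representation.IntertwiningMap.isIntertwining _ _ (e' f) g v
      · rw [he, hE₁, ← hM₁ i hne g f v, ← hE₁ v (ρM₁ i g f), he, ← hM₂ i hne g (e' f) v]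
        congr 1
        simpa using LinearMap.congr_fun (he' i g) f

include hs in
/-- **Finite-family isotypic rigidity.**  Let `(G i)_{i ∈ ι}` be a FINITE family of groups acting on the `k`-spaces
`X₁` and `X₂` through pairwise commuting representations `ρ₁ i`, `ρ₂ i`, and let `τ i` be irreducible representations
of the `G i` with scalar commutant (`∀ φ ∈ Hom_{G i}(τ i, τ i), ∃ c, φ = c • id`).  If `X₁` and `X₂` are non-zero, have
NO proper non-zero `k`-submodule stable under the whole family, and are `τ i`-isotypic for every `i`
(`isotypicComponent k[G i] (ρ_j i).asModule (τ i).asModule = ⊤`), then `X₁ ≅ X₂` `k`-linearly and equivariantly for the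
whole family.  (Both are `≅ ⨂_i τ i`: the uniqueness half of the classification of the irreducible modules over a finite
tensor product, Bump 1997 Prop. 3.4.1–3.4.2 / Bourbaki *Algèbre* VIII §7 n°7 / Bernstein–Zelevinsky 1976 §2.16 /
Flath 1979 Thm. 1 — here with the scalar-commutant hypothesis in place of finite dimension and algebraic closure.)
[cite: Bump1997, Prop. 3.4.2] -/
theorem exists_equiv_of_isotypic [Finite ι] (X₁ X₂ : Type u) [AddCommGroup X₁] [Module k X₁]
    [AddCommGroup X₂] [Module k X₂] [Nontrivial X₁] [Nontrivial X₂]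
    (ρ₁ : ∀ i, Representation k (G i) X₁) (ρ₂ : ∀ i, Representation k (G i) X₂)
    (hc₁ : Pairwise fun i j => ∀ (g : G i) (h : G j), ρ₁ i g ∘ₗ ρ₁ j h = ρ₁ j h ∘ₗ ρ₁ i g)
    (hc₂ : Pairwise fun i j => ∀ (g : G i) (h : G j), ρ₂ i g ∘ₗ ρ₂ j h = ρ₂ j h ∘ₗ ρ₂ i g)
    (hiso₁ : ∀ i, isotypicComponent (MonoidAlgebra k (G i)) (ρ₁ i).asModule (τ i).asModule = ⊤)
    (hiso₂ : ∀ i, isotypicComponent (MonoidAlgebra k (G i)) (ρ₂ i).asModule (τ i).asModule = ⊤)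
    (hirr₁ : ∀ N : Submodule k X₁, (∀ i (g : G i), N ≤ N.comap (ρ₁ i g)) → N = ⊥ ∨ N = ⊤)
    (hirr₂ : ∀ N : Submodule k X₂, (∀ i (g : G i), N ≤ N.comap (ρ₂ i g)) → N = ⊥ ∨ N = ⊤) :
    ∃ e : X₁ ≃ₗ[k] X₂, ∀ i (g : G i), e.toLinearMap ∘ₗ ρ₁ i g = ρ₂ i g ∘ₗ e.toLinearMap := by
  classical
  cases nonempty_fintype ι
  exact exists_equiv_of_isotypic_aux τ hs Finset.univ X₁ X₂ ρ₁ ρ₂ hc₁ hc₂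
    (fun i hi => absurd (Finset.mem_univ i) hi) (fun i hi => absurd (Finset.mem_univ i) hi)
    (fun i _ => hiso₁ i) (fun i _ => hiso₂ i) hirr₁ hirr₂

end Rigidity

end Literature.RepresentationTheory
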